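import Mathlib
import Literature.AlgebraicGeometry.HodgeTheory.WeilClassesBlochSeed
import HarnessLib

/-!
# Route `EightfoldBlochSeeds`, cruxes `BlochSeedsGeneric` (stmt-HodgeConjecture-18880) / `BlochSeedDiscThree` (18882), line
# `pad4-cm-anchor`, stub `stub_pad4_carrier`: the NEWTON STEP of the census no-go «commuting twisted-Poincaré CI designs for the
# carrier class `q·h_K⁴ + w` need a fourth root of unity in `K = ℚ(√-d)`» — kernel-checked pure algebra

HONEST FRAMING. Nothing here proves a registered stub, either crux, rung H2, HC_AV or the Hodge conjecture; nothing is constructed.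
UNCONDITIONAL lemmas of pure algebra (no named fact, no definition, no Literature fact; D-0026). Census-neutral. This file is the
kernel-checked core of Theorem B of the evidence note `CENSUS-squareclass-cyclotomic-leafhand-1-g2.md` (items 18880/18882); the
reduction from the stub to the algebra below is PEN (exterior-algebra bookkeeping on `H^*(E₀⁸) = Λ(V ⊕ V̄)`), summarised here so a
reader can audit it, and is NOT claimed as a theorem of the tree.

THE REDUCTION (pen, loc. cit. §2). On the PAD-4 anchor `S⁴ = Y × Y'` (`Y = E₁E₃E₅E₇`, `Y' = E₂E₄E₆E₈`) a complete intersection of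
four divisors `ℓ_k = η + A∘G_k + conj` (common ample `K`-invariant part `η`, Poincaré-type correspondence class `A`, twists
`G_k ∈ End(E₀⁴) ⊗ ℚ = M₄(K)`) has class `q·h_K⁴ + w` with `w ≠ 0` in the Weil plane only if the `Y`-charge `1, 2, 3` components of
`Πℓ_k` vanish and the charge-`4` component does not; by hard-Lefschetz injectivity of `η·` in the relevant bidegrees this is
`e₁ = e₂ = e₃ = 0 ≠ e₄` for the commuting even elements `A∘G_k`, and when the `G_k` are SIMULTANEOUSLY DIAGONAL (the "four Weil
surfaces" designs, twists `g_k ∈ O_K⁴` factorwise) it says: the four columns `c_a = (g_{1a}, …, g_{4a}) ∈ K⁴` are non-zero, sum to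
zero, are pairwise orthogonal for the BILINEAR form `Σ_k x_k y_k`, have vanishing triple Hadamard sums and a non-vanishing quadruple
one. Four pairwise-orthogonal non-zero vectors of the non-degenerate ternary space `𝟙^⊥ ≅ ⟨1,1,1⟩_K` lie on one isotropic line
`K·c`, whence the POWER SUMS `p₁(c) = p₂(c) = p₃(c) = 0 ≠ p₄(c)` — and THAT is impossible unless `K ∋ i` (this file):

* `exists_sq_eq_neg_one_of_powerSum_eq_zero` — in a field of characteristic `0`, four elements with `p₁ = p₂ = p₃ = 0` and `p₄ ≠ 0`
  force a square root of `-1` (Newton: `e₁ = e₂ = e₃ = 0`, so each element is a root of `t⁴ + e₄`, `e₄ ≠ 0`; if `-1` is not a square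
  every ratio of roots is `±1` and then `p₂ = 4c₁² ≠ 0`).
* `not_exists_powerSum_design_real`, `not_exists_powerSum_design_rat` — hence no such quadruple over `ℝ` or `ℚ`; for
  `K = ℚ(√-d)` the conclusion `i ∈ K` means `d` is a perfect square, i.e. exactly the square class that p821014
  (`hasHyperbolicBlochSeed_sq_of_blochSeedDiscOne`) delegates to the sibling crux `BlochSeedDiscOne`: on the residual square-free
  domain of `BlochSeedsGeneric` and at `d = 3` no commuting-twist CI design exists (census C5-commuting CLOSED; non-commuting OPEN).

## References

[cite: Bloch1972Semiregularity, Remark (7.5)] [cite: Fulton1998, Example 14.1.1] [cite: vanGeemen1994HodgeAV, 5.3–5.5]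
-/

-- single-problem summit (Problem = Summit): the mandated namespace repeats `HodgeConjecture`.
set_option linter.dupNamespace false

namespace Summit.HodgeConjecture.HodgeConjecture.Theorems

/-- **Newton step.** In a field of characteristic zero, if `a + b + c + e = 0`, `a² + b² + c² + e² = 0`, `a³ + b³ + c³ + e³ = 0` and
`a⁴ + b⁴ + c⁴ + e⁴ ≠ 0`, then `-1` is a square: Newton's identities give `e₂ = e₃ = 0`, so each of `a, b, c, e` is a root of `t⁴ + e₄`
with `e₄ = abce ≠ 0`; if `-1` were not a square, `x⁴ = a⁴` would force `x² = a²` for `x = b, c, e`, and then `p₂ = 4a² ≠ 0`.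
[folklore] -/
theorem exists_sq_eq_neg_one_of_powerSum_eq_zero {F : Type*} [Field F] [CharZero F] {a b c e : F}
    (h1 : a + b + c + e = 0) (h2 : a ^ 2 + b ^ 2 + c ^ 2 + e ^ 2 = 0) (h3 : a ^ 3 + b ^ 3 + c ^ 3 + e ^ 3 = 0)
    (h4 : a ^ 4 + b ^ 4 + c ^ 4 + e ^ 4 ≠ 0) : ∃ i : F, i ^ 2 = -1 := by
  -- Newton: `2 e₂ = p₁² - p₂`, `3 e₃ = p₃ - e₁ p₂ + e₂ p₁`
  have hE2 : a * b + a * c + a * e + b * c + b * e + c * e = 0 := by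
    have h : (2 : F) * (a * b + a * c + a * e + b * c + b * e + c * e) =
        (a + b + c + e) ^ 2 - (a ^ 2 + b ^ 2 + c ^ 2 + e ^ 2) := by ring
    rw [h1, h2] at h
    have h2F : (2 : F) ≠ 0 := two_ne_zero
    simpa [h2F] using h
  have hE3 : a * b * c + a * b * e + a * c * e + b * c * e = 0 := by
    have h : (3 : F) * (a * b * c + a * b * e + a * c * e + b * c * e) =
        (a ^ 3 + b ^ 3 + c ^ 3 + e ^ 3) - (a + b + c + e) * (a ^ 2 + b ^ 2 + c ^ 2 + e ^ 2) +
          (a * b + a * c + a * e + b * c + b * e + c * e) * (a + b + c + e) := by ring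
    rw [h1, h2, h3, hE2] at h
    have h3F : (3 : F) ≠ 0 := three_ne_zero
    simpa [h3F] using h
  -- Vieta at each root: `x⁴ + e₄ = e₁ x³ - e₂ x² + e₃ x = 0`
  have hVa : a ^ 4 + a * b * c * e = a ^ 3 * (a + b + c + e) - a ^ 2 * (a * b + a * c + a * e + b * c + b * e + c * e) +
      a * (a * b * c + a * b * e + a * c * e + b * c * e) := by ring
  have hVb : b ^ 4 + a * b * c * e = b ^ 3 * (a + b + c + e) - b ^ 2 * (a * b + a * c + a * e + b * c + b * e + c * e) +
      b * (a * b * c + a * b * e + a * c * e + b * c * e) := by ring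
  have hVc : c ^ 4 + a * b * c * e = c ^ 3 * (a + b + c + e) - c ^ 2 * (a * b + a * c + a * e + b * c + b * e + c * e) +
      c * (a * b * c + a * b * e + a * c * e + b * c * e) := by ring
  have hVe : e ^ 4 + a * b * c * e = e ^ 3 * (a + b + c + e) - e ^ 2 * (a * b + a * c + a * e + b * c + b * e + c * e) +
      e * (a * b * c + a * b * e + a * c * e + b * c * e) := by ring
  rw [h1, hE2, hE3, mul_zero, mul_zero, mul_zero, sub_zero, add_zero] at hVa hVb hVc hVe
  -- so `x⁴ = a⁴` for `x = b, c, e`, and `a ≠ 0`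
  have hb4 : b ^ 4 = a ^ 4 := by linear_combination hVb - hVa
  have hc4 : c ^ 4 = a ^ 4 := by linear_combination hVc - hVa
  have he4 : e ^ 4 = a ^ 4 := by linear_combination hVe - hVa
  have ha0 : a ≠ 0 := by
    rintro rfl
    apply h4
    rw [hb4, hc4, he4]
    ring
  -- if `-1` is not a square, `x⁴ = a⁴` forces `x² = a²`
  by_contra hni
  have key : ∀ x : F, x ^ 4 = a ^ 4 → x ^ 2 = a ^ 2 := by
    intro x hx
    have hfac : (x ^ 2 - a ^ 2) * (x ^ 2 + a ^ 2) = 0 := by linear_combination hx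
    rcases mul_eq_zero.1 hfac with h0 | h0
    · exact sub_eq_zero.1 h0
    · exfalso
      refine hni ⟨x / a, ?_⟩
      field_simp
      linear_combination h0
  have hsum : (4 : F) * a ^ 2 = 0 := by
    linear_combination h2 - key b hb4 - key c hc4 - key e he4
  have h4F : (4 : F) ≠ 0 := by norm_num
  exact ha0 (pow_eq_zero_iff two_ne_zero |>.1 ((mul_eq_zero.1 hsum).resolve_left h4F))

/-- **No real commuting-twist design**: there are no real `a, b, c, e` with `p₁ = p₂ = p₃ = 0 ≠ p₄` (over `ℝ`, already `p₂ = 0`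
forces `a = b = c = e = 0`; recorded as the instance `F = ℝ` of the Newton step for uniformity). [folklore] -/
theorem not_exists_powerSum_design_real : ¬ ∃ a b c e : ℝ, a + b + c + e = 0 ∧ a ^ 2 + b ^ 2 + c ^ 2 + e ^ 2 = 0 ∧
    a ^ 3 + b ^ 3 + c ^ 3 + e ^ 3 = 0 ∧ a ^ 4 + b ^ 4 + c ^ 4 + e ^ 4 ≠ 0 := by
  rintro ⟨a, b, c, e, h1, h2, h3, h4⟩
  obtain ⟨i, hi⟩ := exists_sq_eq_neg_one_of_powerSum_eq_zero h1 h2 h3 h4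
  nlinarith [sq_nonneg i]

/-- **No rational commuting-twist design**: there are no rational `a, b, c, e` with `p₁ = p₂ = p₃ = 0 ≠ p₄` (`-1` is not a square in
`ℚ`). For `K = ℚ(√-d)` the Newton step says such a quadruple exists only if `i ∈ K`, i.e. only if `d` is a perfect square.
[folklore] -/
theorem not_exists_powerSum_design_rat : ¬ ∃ a b c e : ℚ, a + b + c + e = 0 ∧ a ^ 2 + b ^ 2 + c ^ 2 + e ^ 2 = 0 ∧
    a ^ 3 + b ^ 3 + c ^ 3 + e ^ 3 = 0 ∧ a ^ 4 + b ^ 4 + c ^ 4 + e ^ 4 ≠ 0 := by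
  rintro ⟨a, b, c, e, h1, h2, h3, h4⟩
  obtain ⟨i, hi⟩ := exists_sq_eq_neg_one_of_powerSum_eq_zero h1 h2 h3 h4
  nlinarith [sq_nonneg i]

end Summit.HodgeConjecture.HodgeConjecture.Theorems
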